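import Summits.CriticalPhenomena.Ising3DConformalLimit.Theorems.InverseSquareTelemetryTwoPointSpineComplementHalfEdge
import Summits.CriticalPhenomena.Ising3DConformalLimit.Theorems.InverseSquareTelemetryPowerLawFromTelemetry
import HarnessLib

/-!
# Crux `InverseSquareTelemetry.TwoPointSpineComplement` (stmt-CriticalPhenomena-4497) against the route's own
# telemetry: under (C) and (A) the telemetric constant `κ` of (T) lies in `(0, 3/4]` (lead c3; `--supports`)

THEOREM-ONLY helper file (no definition, no named fact, no `sorry`). Route `InverseSquareTelemetry` derives the
two-point law from (T) `InverseSquareLaw` (`|x|₂²·(Δ_{ℤ³}G)/G → κ`, `κ ≥ 0`, Dini rate) and (A)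
`PositiveSolutionAsymptotics` (lattice Agmon–Murata–Pinchover: `G·|x|₂^{α₊} → c > 0`, `α₊ = (1+√(1+4κ))/2`), and then
asks the crux (C) for the conformal limit with `Δ = α₊/2`. The landed `HalfEdge.noCoulombLaw_of_twoPointSpineComplement`
((C) forbids the exact Coulomb law) and `HalfEdge.window_of_twoPointSpineComplement` ((C) puts every law witness in
`1/2 < Δ ≤ 3/4`) translate into a constraint on the route's OWN parameter:

* `telemetryWindow_of_crux` (registered bookkeeping stub; header on one line) — (C) → (A) → for every telemetric datum
  `(κ, ε, C)` of the shape of (T): `0 < κ ∧ κ ≤ 3/4`. In particular the HARMONIC telemetry `κ = 0` (which (A) turns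
  into the Coulomb law `G·|x|₂ → c`) is incompatible with (C): `harmonicTelemetry_false_of_crux`.
* Reading for the planner: on this route the clause `0 ≤ κ` of (T) may be sharpened to `0 < κ ≤ 3/4` at no cost
  (conjecturally `κ = η(1+η)/…`; the card's value `κ ≈ 0.0376`), and the assembly (T) → (A) → 0634 → (C) can only ever
  be run with an anomalous exponent `2Δ = α₊(κ) ∈ (1, 3/2]`.

References: Callen, Phys. Lett. 4 (1963) 161; Duminil-Copin, ICM 2022, §8.1; Duminil-Copin–Panis, CMP 406 (2025) Thm 1.5;
Pohlmeyer, Comm. Math. Phys. 12 (1969) 204.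
-/

noncomputable section

namespace Summit.CriticalPhenomena.Ising3DConformalLimit.InverseSquareTelemetryTwoPointSpineComplement.Telemetry

open Literature.Probability.LatticeModels Filter Topology
open Summit.CriticalPhenomena.Ising3DConformalLimit.Theses.InverseSquareTelemetry
  (TwoPointSpineComplement PositiveSolutionAsymptotics InverseSquareLaw)
open Summit.CriticalPhenomena.Ising3DConformalLimit.Theorems
  (site_three_ne_zero_of_one_le_sqrt criticalTwoPoint_three_pos_of_ne_zero)
open Summit.CriticalPhenomena.Ising3DConformalLimit.InverseSquareTelemetryTwoPointSpineComplement.HalfEdge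
  (window_of_twoPointSpineComplement noCoulombLaw_of_twoPointSpineComplement)

/-- **(A) turns a telemetric datum `(κ, ε, C)` into the pure power law with exponent `2Δ = α₊(κ)`** (the instantiation
`u := G`, `V := Δ_{ℤ³}G/G`, `R := 1` of `powerLawFromTelemetry_proof`, with `κ` kept explicit). [folklore] -/
theorem law_of_telemetry_of_asymptotics (hA : PositiveSolutionAsymptotics) {κ ε C : ℝ} (hκ : 0 ≤ κ) (hε : 0 < ε)
    (hb : ∀ x : Site 3, x ≠ 0 →
      |(∑ i, ((x i : ℝ)) ^ 2) * (((∑ i : Fin 3, (criticalTwoPoint 3 (x + Pi.single i 1) +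
        criticalTwoPoint 3 (x - Pi.single i 1))) - 6 * criticalTwoPoint 3 x) / criticalTwoPoint 3 x) - κ| ≤
        C * Real.sqrt (∑ i, ((x i : ℝ)) ^ 2) ^ (-ε)) :
    ∃ c : ℝ, 0 < c ∧ Tendsto (fun x : Site 3 =>
      criticalTwoPoint 3 x * Real.sqrt (∑ i, ((x i : ℝ)) ^ 2) ^ (2 * ((1 + Real.sqrt (1 + 4 * κ)) / 2 / 2)))
      cofinite (nhds c) := by
  have hne : ∀ x : Site 3, (1 : ℝ) ≤ Real.sqrt (∑ i, ((x i : ℝ)) ^ 2) → x ≠ 0 :=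
    fun x hx => site_three_ne_zero_of_one_le_sqrt hx
  obtain ⟨c, hc, ht⟩ := hA κ ε C hκ hε (criticalTwoPoint 3)
    (fun x => ((∑ i : Fin 3, (criticalTwoPoint 3 (x + Pi.single i 1)
      + criticalTwoPoint 3 (x - Pi.single i 1))) - 6 * criticalTwoPoint 3 x) /
        criticalTwoPoint 3 x)
    1
    (fun x hx => criticalTwoPoint_three_pos_of_ne_zero (hne x hx))
    (fun x hx => (div_mul_cancel₀ _ (criticalTwoPoint_three_pos_of_ne_zero (hne x hx)).ne').symm)
    (fun x hx => hb x (hne x hx))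
    criticalTwoPoint_tendsto_zero_cofinite
  refine ⟨c, hc, ?_⟩
  have h2 : 2 * ((1 + Real.sqrt (1 + 4 * κ)) / 2 / 2) = (1 + Real.sqrt (1 + 4 * κ)) / 2 := by ring
  rw [h2]
  exact ht

/-- **(C) + (A) put the telemetric constant in `(0, 3/4]` (registered bookkeeping stub of this `--supports` file; header on one line).** Given the crux (C) and the asymptotics (A), every datum `(κ, ε, C)` of the shape of (T) — `κ ≥ 0`, `ε > 0`, `||x|₂²·(Δ_{ℤ³}G)(x)/G(x) − κ| ≤ C|x|₂^{−ε}` off the origin — has `0 < κ ≤ 3/4`: (A) gives the law with `2Δ = α₊(κ) = (1+√(1+4κ))/2`, and (C) forces `1/2 < Δ ≤ 3/4` (`HalfEdge.window_of_twoPointSpineComplement`), i.e. `1 < √(1+4κ) ≤ 2`. [cite: DuminilCopinPanis2025LowerBounds, Theorem 1.5] -/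
theorem telemetryWindow_of_crux : Summit.CriticalPhenomena.Ising3DConformalLimit.Theses.InverseSquareTelemetry.TwoPointSpineComplement → Summit.CriticalPhenomena.Ising3DConformalLimit.Theses.InverseSquareTelemetry.PositiveSolutionAsymptotics → ∀ κ ε C : ℝ, 0 ≤ κ → 0 < ε → (∀ x : Literature.Probability.LatticeModels.Site 3, x ≠ 0 → |(∑ i, ((x i : ℝ)) ^ 2) * (((∑ i : Fin 3, (Literature.Probability.LatticeModels.criticalTwoPoint 3 (x + Pi.single i 1) + Literature.Probability.LatticeModels.criticalTwoPoint 3 (x - Pi.single i 1))) - 6 * Literature.Probability.LatticeModels.criticalTwoPoint 3 x) / Literature.Probability.LatticeModels.criticalTwoPoint 3 x) - κ| ≤ C * Real.sqrt (∑ i, ((x i : ℝ)) ^ 2) ^ (-ε)) → 0 < κ ∧ κ ≤ 3 / 4 := by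
  intro hC hA κ ε C hκ hε hb
  obtain ⟨c, hc, hP⟩ := law_of_telemetry_of_asymptotics hA hκ hε hb
  obtain ⟨h₁, h₂⟩ := window_of_twoPointSpineComplement hC hc hP
  have hs0 : 0 ≤ Real.sqrt (1 + 4 * κ) := Real.sqrt_nonneg _
  have hss : Real.sqrt (1 + 4 * κ) ^ 2 = 1 + 4 * κ := Real.sq_sqrt (by linarith)
  constructor
  · nlinarith
  · nlinarith

/-- **Harmonic telemetry is incompatible with (C).** Under (A), a telemetric datum with `κ = 0` (i.e.
`|x|₂²·(Δ_{ℤ³}G)/G → 0` at a Dini rate) yields the exact Coulomb law `G·|x|₂ → c > 0`, which the crux forbids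
(`HalfEdge.noCoulombLaw_of_twoPointSpineComplement`). So the assembly of the route can only be run with `κ > 0`. [folklore] -/
theorem harmonicTelemetry_false_of_crux (hC : TwoPointSpineComplement) (hA : PositiveSolutionAsymptotics) :
    ¬ ∃ ε C : ℝ, 0 < ε ∧ ∀ x : Site 3, x ≠ 0 →
      |(∑ i, ((x i : ℝ)) ^ 2) * (((∑ i : Fin 3, (criticalTwoPoint 3 (x + Pi.single i 1) +
        criticalTwoPoint 3 (x - Pi.single i 1))) - 6 * criticalTwoPoint 3 x) / criticalTwoPoint 3 x) - 0| ≤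
        C * Real.sqrt (∑ i, ((x i : ℝ)) ^ 2) ^ (-ε) := by
  rintro ⟨ε, C, hε, hb⟩
  exact lt_irrefl (0:ℝ) (telemetryWindow_of_crux hC hA 0 ε C le_rfl hε hb).1

/-- **The route's (T) sharpened by (C) + (A):** if `InverseSquareLaw` holds at all then, under (C) and (A), it holds
with a telemetric constant in `(0, 3/4]`. [folklore] -/
theorem inverseSquareLaw_sharp_of_crux (hC : TwoPointSpineComplement) (hA : PositiveSolutionAsymptotics)
    (hT : InverseSquareLaw) :
    ∃ κ ε C : ℝ, 0 < κ ∧ κ ≤ 3 / 4 ∧ 0 < ε ∧ ∀ x : Site 3, x ≠ 0 →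
      |(∑ i, ((x i : ℝ)) ^ 2) * (((∑ i : Fin 3, (criticalTwoPoint 3 (x + Pi.single i 1) +
        criticalTwoPoint 3 (x - Pi.single i 1))) - 6 * criticalTwoPoint 3 x) / criticalTwoPoint 3 x) - κ| ≤
        C * Real.sqrt (∑ i, ((x i : ℝ)) ^ 2) ^ (-ε) := by
  obtain ⟨κ, ε, C, hκ, hε, hb⟩ := hT
  obtain ⟨hκ0, hκ1⟩ := telemetryWindow_of_crux hC hA κ ε C hκ hε hb
  exact ⟨κ, ε, C, hκ0, hκ1, hε, hb⟩

end Summit.CriticalPhenomena.Ising3DConformalLimit.InverseSquareTelemetryTwoPointSpineComplement.Telemetry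

end
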